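import Summits.QuantumFields.YangMills.Theorems.LuscherReductionTwistedTraceScalingTubeAdmissible
import HarnessLib

/-!
# C4 INNER ONE-ORBIT ⇐ the tube min–max statement with a SOFT (non-idempotent) Faddeev–Popov weight — e.g. a Gaussian concentration on a thin gauge slice
# inside a fat admissible tube
# (lane A of S-BASE, crux `TwistedTraceScaling` stmt-QuantumFields-20203, sub-target C4 INNER; design note `pub/ym-fleet/ym-luscher-20007-p1/COARSE-DESIGN.md` §23.4)

WHY SOFT.  The Born–Oppenheimer analysis of the gauge-averaged kernel `K̃_β = avgKernel β` wants the test functions concentrated on a THIN gauge slice (extent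
`δ_g ≲ β^{-1/2}·polylog` in the gauge-linear directions, so that the curvature `O(η²)` of the orbits is negligible against the stiff width), while admissibility
(`…TubeAdmissible.tubeAdmissible_of_sandwich`) wants the tube FAT (`⊇ nearOne ρ ∩ {orbitDist < δ}`, `ρ ≥ 2δ`).  A soft weight `χ = 𝟙_{T_fat} · w`, `0 < m ≤ w ≤ 1`
(e.g. `w = exp(−|gauge coordinate|²/δ_g²)`), has both: positivity and coverage are those of the fat tube, concentration is Gaussian.  The gauge slice identity
(`…GaugeSlice`) holds for every bounded measurable weight: with `N = gaugeAvg χ` and `f = sliceFn χ ψ = ψχ/N`,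
`⟨ψ, K_β ψ⟩ = ∫∫ f K̃_β f` (`qform_eq_integral_avgKernel`) and `‖ψ‖² = ∫ f ψ = ∫ f² · (N/χ)` (`l2_eq_sliceFn_left`; the norm weight is `N/χ = N·e^{+|η|²/δ_g²}` in the example).
* `softWeight χ = gaugeAvg χ / χ` (junk where `χ = 0`); `SoftTubeNoIntruderAt L χ` — the min–max statement for `K̃_β` on `L²(supp χ, (N/χ) dU)` over arbitrary bounded measurable
  families (target text; OPEN); `SoftTubeAdmissible L δ χ` — `χ` bounded measurable, eventually `N > 0` on the inner region and `N ≥ n₀ > 0` on `supp χ`.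
* ★★★ `innerNoIntruderOneOrbitAt_of_softTube : SoftTubeAdmissible L δ χ → SoftTubeNoIntruderAt L χ → InnerNoIntruderOneOrbitAt L δ`.
* ★★ `softTubeAdmissible_of_sandwich`: `χ β = 𝟙_{T β} · w β` with `T` sandwiched (`nearOne ρ ∩ {orbitDist < δ β} ⊆ T β ⊆ {orbitDist < δ β}`, `δ β ≤ ρ/2`), `w β` measurable,
  `m β ≤ w β ≤ 1` on `T β` with `m β > 0` ⇒ admissible (`N ≥ m β · Haar(gaugeBall ρ/4)`).
HONEST FRAMING: an exact reduction for a stub of a child of the CONDITIONAL reduction route R2b1; `SoftTubeNoIntruderAt` OPEN; not infinite volume, not a gap, not Clay.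
-/

set_option autoImplicit false

noncomputable section

open MeasureTheory Filter Topology Real
open scoped BigOperators
open Literature.MathematicalPhysics.QuantumFieldTheory
open Literature.MathematicalPhysics.QuantumLattice

namespace Summit.QuantumFields.YangMills.Theorems.FemtoTransferGap

open TwoLattice.Avg

variable {L : ℕ} [NeZero L]

/-! ## §1 The target texts -/

/-- The norm weight of a soft slice: `N/χ = gaugeAvg χ / χ` (junk `0` where `χ = 0`; slice functions vanish there). [cite: SeilerLNP1982, §2] -/
def softWeight (χ : GaugeConfig 3 L SU2 → ℝ) : GaugeConfig 3 L SU2 → ℝ := fun U => gaugeAvg χ U / χ U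

variable (L) in
/-- **SOFT TUBE NO-INTRUDER** (target text; OPEN): for every `k`, `ε > 0`, eventually in `β`, every family of `k+1` bounded measurable functions supported in `supp (χ β)`,
nondegenerate in `L²((N/χ) dU)`, has a nonzero combination `f` with `(∫∫ f K̃_β f)·μ₀(L³β) ≤ e^{ελ_b(L³β)}·μ_k(L³β)·λ₀(β,L)·∫ f²·(N/χ)`; NO gauge invariance is asked.
[cite: Luscher1983, §3] -/
def SoftTubeNoIntruderAt (χ : ℝ → GaugeConfig 3 L SU2 → ℝ) : Prop :=
  ∀ k : ℕ, ∀ ε : ℝ, 0 < ε → ∃ β0 : ℝ, ∀ β : ℝ, β0 ≤ β →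
    ∀ f : Fin (k + 1) → (GaugeConfig 3 L SU2 → ℝ),
      (∀ i, Measurable (f i)) → (∀ i, ∃ C : ℝ, ∀ U, |f i U| ≤ C) → (∀ i U, f i U ≠ 0 → χ β U ≠ 0) →
      (∀ a : Fin (k + 1) → ℝ, a ≠ 0 → 0 < ∫ U, (∑ i, a i * f i U) ^ 2 * softWeight (χ β) U ∂configMeasure SU2 L) →
        ∃ a : Fin (k + 1) → ℝ, a ≠ 0 ∧
          (∫ U, ∫ V, (∑ i, a i * f i U) * avgKernel β U V * (∑ i, a i * f i V) ∂configMeasure SU2 L ∂configMeasure SU2 L) *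
              levelValue su2Rep 1 ((L : ℝ) ^ 3 * β) 0 ≤
            Real.exp (ε * bareLambda ((L : ℝ) ^ 3 * β)) * levelValue su2Rep 1 ((L : ℝ) ^ 3 * β) k * levelValue su2Rep L β 0 *
              ∫ U, (∑ i, a i * f i U) ^ 2 * softWeight (χ β) U ∂configMeasure SU2 L

variable (L) in
/-- **ADMISSIBLE SOFT WEIGHTS** for the inner region `{orbitDist < δ}`: bounded measurable, eventually with gauge average positive on the inner region and bounded below on
the support. [folklore] -/
def SoftTubeAdmissible (δ : ℝ → ℝ) (χ : ℝ → GaugeConfig 3 L SU2 → ℝ) : Prop :=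
  (∀ β, Measurable (χ β)) ∧ (∀ β, ∃ C : ℝ, ∀ U, |χ β U| ≤ C) ∧
    ∃ β1 : ℝ, ∀ β : ℝ, β1 ≤ β →
      (∀ U : GaugeConfig 3 L SU2, orbitDist U < δ β → 0 < gaugeAvg (χ β) U) ∧
        ∃ n₀ : ℝ, 0 < n₀ ∧ ∀ U, χ β U ≠ 0 → n₀ ≤ gaugeAvg (χ β) U

/-! ## §2 ★★★ The reduction -/

/-- The pointwise identity behind the weighted norm: `f·ψ = f²·(N/χ)` for `f = sliceFn χ ψ` (both sides vanish where `χ = 0`). [folklore] -/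
theorem sliceFn_mul_self_eq {χ ψ : GaugeConfig 3 L SU2 → ℝ} {n₀ : ℝ} (hn₀ : 0 < n₀) (hN : ∀ U, χ U ≠ 0 → n₀ ≤ gaugeAvg χ U) (U : GaugeConfig 3 L SU2) :
    sliceFn χ ψ U * ψ U = sliceFn χ ψ U ^ 2 * softWeight χ U := by
  unfold sliceFn softWeight
  by_cases h : χ U = 0
  · simp [h]
  · have hNpos : gaugeAvg χ U ≠ 0 := (hn₀.trans_le (hN U h)).ne'
    field_simp

/-- ★★★ **C4 INNER ONE-ORBIT from the SOFT TUBE statement**: for an admissible soft weight, the tube min–max statement for the gauge-averaged kernel (no invariance) implies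
`InnerNoIntruderOneOrbitAt L δ`. [cite: Luscher1983, §3] -/
theorem innerNoIntruderOneOrbitAt_of_softTube {δ : ℝ → ℝ} {χ : ℝ → GaugeConfig 3 L SU2 → ℝ} (hT : SoftTubeAdmissible L δ χ) (hN : SoftTubeNoIntruderAt L χ) :
    InnerNoIntruderOneOrbitAt L δ := by
  obtain ⟨hχm, hχb, β1, hβ1⟩ := hT
  intro k ε hε
  obtain ⟨β0, hβ0⟩ := hN k ε hε
  refine ⟨max β0 β1, fun β hβ G hGm hGb hGinv hGsupp hGind => ?_⟩
  have hβ0' : β0 ≤ β := (le_max_left _ _).trans hβ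
  obtain ⟨hcov, n₀, hn₀, hNlow⟩ := hβ1 β ((le_max_right _ _).trans hβ)
  obtain ⟨Cχ, hCχ⟩ := hχb β
  set f : Fin (k + 1) → GaugeConfig 3 L SU2 → ℝ := fun i => sliceFn (χ β) (G i) with hf_def
  have hψ : ∀ a : Fin (k + 1) → ℝ,
      Measurable (fun U => ∑ i, a i * G i U) ∧ (∃ C : ℝ, ∀ U, |∑ i, a i * G i U| ≤ C) ∧
        (∀ (g : Site 3 L → SU2) (U : GaugeConfig 3 L SU2), (∑ i, a i * G i (gaugeTransform g U)) = ∑ i, a i * G i U) ∧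
        (∀ U, (∑ i, a i * G i U) ≠ 0 → gaugeAvg (χ β) U ≠ 0) := fun a =>
    ⟨measurable_combination hGm a, bounded_combination hGb a, invariant_combination hGinv a, fun U hU => by
      obtain ⟨i, hi⟩ := exists_ne_zero_of_combination_ne_zero hU
      exact (hcov U (hGsupp i U hi)).ne'⟩
  have hslice : ∀ a : Fin (k + 1) → ℝ, sliceFn (χ β) (fun U => ∑ i, a i * G i U) = fun U => ∑ i, a i * f i U := fun a => sliceFn_sum (χ β) a G
  have hpack : ∀ a : Fin (k + 1) → ℝ,
      l2 (fun U => ∑ i, a i * G i U) (fun U => ∑ i, a i * G i U) = ∫ U, (∑ i, a i * f i U) ^ 2 * softWeight (χ β) U ∂configMeasure SU2 L ∧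
      qform su2Rep β (fun U => ∑ i, a i * G i U) (fun U => ∑ i, a i * G i U) =
        ∫ U, ∫ V, (∑ i, a i * f i U) * avgKernel β U V * (∑ i, a i * f i V) ∂configMeasure SU2 L ∂configMeasure SU2 L := fun a => by
    obtain ⟨hm, ⟨C, hC⟩, hinv, hcv⟩ := hψ a
    have h1 := qform_eq_integral_avgKernel β (hχm β) hCχ hn₀ hNlow hm hC hinv hcv hm hC hinv hcv
    have h2 := l2_eq_sliceFn_left (hχm β) hCχ hn₀ hNlow hm hC hinv hcv hm hC hinv
    rw [hslice a] at h1 h2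
    refine ⟨?_, h1⟩
    rw [h2]
    unfold l2
    refine integral_congr_ae (ae_of_all _ fun U => ?_)
    have h3 := sliceFn_mul_self_eq (ψ := fun U => ∑ i, a i * G i U) hn₀ hNlow U
    rw [hslice a] at h3
    exact h3
  have hfm : ∀ i, Measurable (f i) := fun i => measurable_sliceFn (hχm β) (hGm i)
  have hfb : ∀ i, ∃ C : ℝ, ∀ U, |f i U| ≤ C := fun i => by
    obtain ⟨C, hC⟩ := hGb i
    exact ⟨C * Cχ / n₀, abs_sliceFn_le hCχ hC hn₀ hNlow⟩
  have hfsupp : ∀ i U, f i U ≠ 0 → χ β U ≠ 0 := fun i U hU => (sliceFn_ne_zero hU).1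
  have hfind : ∀ a : Fin (k + 1) → ℝ, a ≠ 0 → 0 < ∫ U, (∑ i, a i * f i U) ^ 2 * softWeight (χ β) U ∂configMeasure SU2 L := fun a ha => by
    rw [← (hpack a).1]; exact hGind a ha
  obtain ⟨a, ha, hle⟩ := hβ0 β hβ0' f hfm hfb hfsupp hfind
  refine ⟨a, ha, ?_⟩
  rw [(hpack a).2, (hpack a).1]
  exact hle

/-! ## §3 ★★ Admissibility of soft weights on sandwiched tubes -/

/-- ★★ **Soft weights on sandwiched tubes are admissible**: `χ β = 𝟙_{T β}·w β` with `T` sandwiched (`nearOne ρ ∩ {orbitDist < δ β} ⊆ T β ⊆ {orbitDist < δ β}`, `δ β ≤ ρ/2`),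
`w β` measurable with `m β ≤ w β ≤ 1` everywhere, `m β > 0`: then `SoftTubeAdmissible L δ χ` with `gaugeAvg (χ β) ≥ m β · Haar(gaugeBall ρ/4)`. [folklore] -/
theorem softTubeAdmissible_of_sandwich {δ : ℝ → ℝ} {T : ℝ → Set (GaugeConfig 3 L SU2)} (hTm : ∀ β, MeasurableSet (T β)) {ρ : ℝ} (hρ : 0 < ρ)
    (h : ∃ β1 : ℝ, ∀ β : ℝ, β1 ≤ β → δ β ≤ ρ / 2 ∧ nearOne L ρ ∩ {W | orbitDist W < δ β} ⊆ T β ∧ T β ⊆ {W | orbitDist W < δ β})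
    {w : ℝ → GaugeConfig 3 L SU2 → ℝ} (hwm : ∀ β, Measurable (w β)) {m : ℝ → ℝ} (hm : ∀ β, 0 < m β) (hmw : ∀ β U, m β ≤ w β U) (hw1 : ∀ β U, w β U ≤ 1) :
    SoftTubeAdmissible L δ fun β => fun U => (T β).indicator (fun _ => (1 : ℝ)) U * w β U := by
  obtain ⟨β1, hβ1⟩ := h
  have hχm : ∀ β, Measurable fun U => (T β).indicator (fun _ => (1 : ℝ)) U * w β U := fun β =>
    (measurable_const.indicator (hTm β)).mul (hwm β)
  have hχb : ∀ β U, |(T β).indicator (fun _ => (1 : ℝ)) U * w β U| ≤ 1 := fun β U => by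
    have h0 : 0 ≤ w β U := (hm β).le.trans (hmw β U)
    by_cases hU : U ∈ T β
    · rw [Set.indicator_of_mem hU, one_mul, abs_of_nonneg h0]; exact hw1 β U
    · rw [Set.indicator_of_notMem hU, zero_mul, abs_zero]; exact zero_le_one
  -- the soft weight dominates `m β · 𝟙_T`
  have hdom : ∀ β U, m β * tubeWeight (T β) U ≤ gaugeAvg (fun U => (T β).indicator (fun _ => (1 : ℝ)) U * w β U) U := fun β U => by
    rw [tubeWeight, ← gaugeAvg_const_mul]
    refine gaugeAvg_mono ((measurable_const.indicator (hTm β)).const_mul _) (hχm β) (C := |m β| * 1) (D := 1)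
      (fun V => by rw [abs_mul]; exact mul_le_mul_of_nonneg_left (abs_indicator_one_le (T β) V) (abs_nonneg _)) (hχb β) (fun V => ?_) U
    by_cases hV : V ∈ T β
    · rw [Set.indicator_of_mem hV, mul_one, one_mul]; exact hmw β V
    · rw [Set.indicator_of_notMem hV, mul_zero, zero_mul]
  refine ⟨hχm, fun β => ⟨1, hχb β⟩, β1, fun β hβ => ?_⟩
  obtain ⟨hδρ, hsub, hsup⟩ := hβ1 β hβ
  have hball : 0 < (gaugeMeasure L).real (gaugeBall L (ρ / 4)) :=
    ENNReal.toReal_pos (gaugeMeasure_gaugeBall_pos L (by linarith)).ne' (measure_ne_top _ _)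
  have hlow : ∀ U, orbitDist U < δ β → m β * (gaugeMeasure L).real (gaugeBall L (ρ / 4)) ≤
      gaugeAvg (fun U => (T β).indicator (fun _ => (1 : ℝ)) U * w β U) U := fun U hU =>
    (mul_le_mul_of_nonneg_left (tubeWeight_ge_of_subset L (hTm β) hδρ hsub hU) (hm β).le).trans (hdom β U)
  refine ⟨fun U hU => (mul_pos (hm β) hball).trans_le (hlow U hU), m β * (gaugeMeasure L).real (gaugeBall L (ρ / 4)), mul_pos (hm β) hball, fun U hU => ?_⟩
  have hUT : U ∈ T β := by
    by_contra h'
    exact hU (show (T β).indicator (fun _ => (1 : ℝ)) U * w β U = 0 by rw [Set.indicator_of_notMem h', zero_mul])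
  exact hlow U (hsup hUT)

end Summit.QuantumFields.YangMills.Theorems.FemtoTransferGap

end
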